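/-
Copyright: the b2b-balaban T⁴-continuum CRUX team, row NE7b OWNER lineage `t4-ne7b-p1` (gen 120). Project licence.
-/
import Summits.QuantumFields.BalabanUV.T4Continuum.Spine.NE7b.SupTorusHessianCombesThomas
import Summits.QuantumFields.BalabanUV.T4Continuum.Spine.NE7b.SupTorusBlockDistance

/-!
# THE DISPLAYED TORUS ACTION `H = (n+1)²(−Δ) + a(n+1)^{−d}(block sums) + V` HAS A SYMMETRIC FORM, IS LINEAR AND INJECTIVE (`V ≥ −λ`,
# `λ < min(2,a)`), AND ITS BLOCK BOOKKEEPING: block indicators pair to block sums, block sums are dominated by total sums, and the fine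
# `ℓ¹` distance to a block corner read on another block is `(n+1)×` the coarse distance `± dκ` after scaling — the algebra the coarse half
# of the locality column ((134) `…SupTorusSchurComplement`) runs on (row NE7b, node U5c; (130)–(132) BY NAME; [folklore])

Cell `pub-balaban`, sub-cell `t4`, spine estimate NE7b (`T4WeightBudget.RelWeightBound`; the cell's OWN estimate — NOT PRINTED in
[Bałaban 1983–89], NOT PROVED).  Crux-route work under `Spine/NE7b/` by the row OWNER (`t4-ne7b-p1` gen 120, file (133)) under FREEZE
(0)'s crux-prover clause; NOTHING of Bałaban's is named as a Lean object, valued or asserted; no `T4Continuum/Support` leaf typed; no `def`,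
no notation (the action is DISPLAYED at every occurrence); zero `sorry`.  Imports (BY NAME): the OWNER's (131) `…SupTorusHessianCombesThomas`
(`weighted_resolvent_le`; through it (130) `sum_translate`, `weighted_form_lower`, (89) TDF `sum_fine_eq_sum_blocks`, `sum_blockLift_mul`, TDFC
`sum_block_comp_siteOf_eq`, `B6QGQLower276.sum_B`) and (132) `…SupTorusBlockDistance` (`fine_coarse_compare`, `isPseudoDist_torus`).

WHY (located).  (134) builds the Schur complement `T = Q′tH⁻¹Q′t*` from the block columns `ψ_{y′}` (`Hψ_{y′} = 𝟙[bt · = y′]`) and needs: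
SYMMETRY of `T` ⇐ symmetry of the form `Σ ψ·Hφ` (torus summation by parts, polarised: `Σ ψ(2φ − φ(·+t) − φ(·−t)) = Σ (ψ(·+t) − ψ)(φ(·+t) − φ)`,
and the block term `Σ_x ψ x Σ_{B(x)} φ = Σ_y (Σ_z ψ)(Σ_z φ)`); UNIQUENESS of solutions of `Hu = f` ⇐ (131)'s resolvent letter at the zero
weight; LINEARITY of the displayed action (for superpositions `Σ_{y′} c_{y′}ψ_{y′}` — the response); and the comparison of (131)'s weight
`(κ∕(n+1))ρ_N(·, corner y′)` on the block `y` with `κρ_s(y, y′)` ⇐ (132) `fine_coarse_compare`.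

WHAT IS PROVED ([folklore]; fine torus `Site d ((n+1)s)`, coarse `Site d s`, `[NeZero s]`, `ê_μ = siteOf (e μ)`, `σ = siteOf`, `wm = windowMap`,
`bt x = σ_s(blk n (wm x))`; `(Hu)(x) = (n+1)²Σ_μ(2u x − u(x+ê_μ) − u(x−ê_μ)) + a(n+1)^{−d}Σ_{q∈B n (blk n (wm x))} u(σ q) + V x·u x`):
* §1 `lapForm_polarised`, `blockForm_polarised`, **`action_form_symm`** (`Σ_x ψ x·(Hφ) x = Σ_x φ x·(Hψ) x`), `action_sub`
  (`H(u − u′) = Hu − Hu′`), **`action_sum_smul`** (`H(Σ_i c_i u_i) = Σ_i c_i Hu_i`), **`action_injective`** (`a ≥ 0`, `V ≥ −λ`,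
  `λ < min(2,a)`: `Hu = Hu′ ⟹ u = u′`).
* §2 **`sum_indicator_mul`** (`Σ_x 𝟙[bt x = y]·f x = Σ_z f(σ(chart n (wm y) z))`), `block_sum_le_total` (`F ≥ 0`: a block sum is at most
  the total), **`weight_on_block`** (`κρ_s(y,y′) − dκ ≤ (κ∕(n+1))·ρ_N(σ(chart (wm y) z), σ(chart (wm y′) 0)) ≤ κρ_s(y,y′) + dκ`).
* §3 toy.

HONEST (what this is NOT).  Finite-sum algebra only; no estimate beyond (131)∕(132) by name; cubic periods; scalar skeleton ((A3),
NC-NE7b-α UNRULED); nothing of Bałaban's.  BY-NAME EFFECT ON THE WALL: NONE.  NE7b NOT PRINTED ∕ NOT PROVED; spine PROVED 0∕9; rung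
(B)+1 on a FINITE torus — NOT infinite volume, NOT the mass gap, NOT Clay.  HONEST DEPENDENCY: continuum YM on T⁴ ⇐ BetaPertH ∧ nine
spine estimates (0∕9 proved); BetaPertH ⇐ (D1) ∧ (D4) ∧ CAP+tail; G-an2-4 gates asym, D1 and NE2∕3∕4.
-/

set_option autoImplicit false

noncomputable section

namespace Summit.QuantumFields.BalabanUV.T4Continuum.NE7b.SupTorusActionForm

open Real
open Literature.MathematicalPhysics.QuantumFieldTheory.Balaban1983to89
open B6QGQLower276 (X e blk B side chart mem_B sum_B sum_B_const card_cube blk_chart)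
open Beta (Site siteOf windowMap siteOf_windowMap siteOf_add)
open SupTorusDirichletForm (sum_fine_eq_sum_blocks siteOf_chart_bijective blockOf_siteOf_of_mem)
open SupTorusDirichletFormCoercive (sum_block_comp_siteOf_eq sum_sq_eq_sum_blocks)
open SupTorusConjugatedForm (weighted_form_lower)
open SupTorusBlockDistance (fine_coarse_compare)

variable {d : ℕ}

/-! ## §1. The displayed action: polarised forms, symmetry, injectivity -/

section Forms

variable (n : ℕ) (a : ℝ) (s : ℕ) [NeZero s]

/-- **THE POLARISED LAPLACIAN FORM** (one shift `t` of a finite torus):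
`Σ_x ψ x·(2φ x − φ(x+t) − φ(x−t)) = Σ_x (ψ(x+t) − ψ x)(φ(x+t) − φ x)`. [folklore] -/
theorem lapForm_polarised {N : ℕ} [NeZero N] (t : Site d N) (φ ψ : Site d N → ℝ) :
    ∑ x, ψ x * (2 * φ x - φ (x + t) - φ (x - t)) = ∑ x, (ψ (x + t) - ψ x) * (φ (x + t) - φ x) := by
  have h1 : ∑ x, ψ x * φ (x - t) = ∑ x, ψ (x + t) * φ x := by
    rw [← SupTorusConjugatedForm.sum_translate t (fun x => ψ x * φ (x - t))]
    exact Finset.sum_congr rfl fun x _ => by rw [add_sub_cancel_right]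
  have h2 : ∑ x, ψ (x + t) * φ (x + t) = ∑ x, ψ x * φ x := SupTorusConjugatedForm.sum_translate t (fun x => ψ x * φ x)
  have hL : ∑ x, ψ x * (2 * φ x - φ (x + t) - φ (x - t))
      = 2 * ∑ x, ψ x * φ x - ∑ x, ψ x * φ (x + t) - ∑ x, ψ x * φ (x - t) := by
    rw [Finset.mul_sum, ← Finset.sum_sub_distrib, ← Finset.sum_sub_distrib]
    exact Finset.sum_congr rfl fun x _ => by ring
  have hR : ∑ x, (ψ (x + t) - ψ x) * (φ (x + t) - φ x)
      = ∑ x, ψ (x + t) * φ (x + t) - ∑ x, ψ (x + t) * φ x - ∑ x, ψ x * φ (x + t) + ∑ x, ψ x * φ x := by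
    rw [← Finset.sum_sub_distrib, ← Finset.sum_sub_distrib, ← Finset.sum_add_distrib]
    exact Finset.sum_congr rfl fun x _ => by ring
  rw [hL, hR, h1, h2]
  ring

/-- **THE POLARISED BLOCK FORM**: `Σ_x ψ x·Σ_{q∈B n (blk n (wm x))} φ(σ q) = Σ_y (Σ_z ψ(σ(chart (wm y) z)))·(Σ_z φ(σ(chart (wm y) z)))`.
[folklore] -/
theorem blockForm_polarised (φ ψ : Site d ((n + 1) * s) → ℝ) :
    ∑ x, ψ x * ∑ q ∈ B n (blk n (windowMap d ((n + 1) * s) x)), φ (siteOf d ((n + 1) * s) q)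
      = ∑ y : Site d s, (∑ z : Fin d → Fin (n + 1), ψ (siteOf d ((n + 1) * s) (chart n (windowMap d s y) z)))
          * ∑ z : Fin d → Fin (n + 1), φ (siteOf d ((n + 1) * s) (chart n (windowMap d s y) z)) := by
  rw [sum_fine_eq_sum_blocks n s]
  refine Finset.sum_congr rfl fun y _ => ?_
  calc ∑ p ∈ B n (windowMap d s y), ψ (siteOf d ((n + 1) * s) p)
          * ∑ q ∈ B n (blk n (windowMap d ((n + 1) * s) (siteOf d ((n + 1) * s) p))), φ (siteOf d ((n + 1) * s) q)
      = ∑ p ∈ B n (windowMap d s y), ψ (siteOf d ((n + 1) * s) p)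
          * ∑ q ∈ B n (windowMap d s y), φ (siteOf d ((n + 1) * s) q) :=
        Finset.sum_congr rfl fun p hp => by rw [sum_block_comp_siteOf_eq n s φ hp]
    _ = (∑ p ∈ B n (windowMap d s y), ψ (siteOf d ((n + 1) * s) p)) * ∑ q ∈ B n (windowMap d s y), φ (siteOf d ((n + 1) * s) q) :=
        (Finset.sum_mul _ _ _).symm
    _ = _ := by rw [sum_B (windowMap d s y) (fun p => ψ (siteOf d ((n + 1) * s) p)), sum_B (windowMap d s y) (fun q => φ (siteOf d ((n + 1) * s) q))]

/-- **THE FORM OF THE DISPLAYED ACTION IS SYMMETRIC**: for `(Hu)(x) = (n+1)²Σ_μ(2u x − u(x+ê_μ) − u(x−ê_μ)) + a(n+1)^{−d}Σ_{q∈B} u(σ q) + V x·u x`,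
`Σ_x ψ x·(Hφ)(x) = Σ_x φ x·(Hψ)(x)`. [folklore] -/
theorem action_form_symm (V φ ψ : Site d ((n + 1) * s) → ℝ) :
    ∑ x, ψ x * (((n : ℝ) + 1) ^ 2 * ∑ μ, (2 * φ x - φ (x + siteOf d ((n + 1) * s) (e μ)) - φ (x - siteOf d ((n + 1) * s) (e μ)))
        + a / ((n : ℝ) + 1) ^ d * ∑ q ∈ B n (blk n (windowMap d ((n + 1) * s) x)), φ (siteOf d ((n + 1) * s) q) + V x * φ x)
      = ∑ x, φ x * (((n : ℝ) + 1) ^ 2 * ∑ μ, (2 * ψ x - ψ (x + siteOf d ((n + 1) * s) (e μ)) - ψ (x - siteOf d ((n + 1) * s) (e μ)))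
        + a / ((n : ℝ) + 1) ^ d * ∑ q ∈ B n (blk n (windowMap d ((n + 1) * s) x)), ψ (siteOf d ((n + 1) * s) q) + V x * ψ x) := by
  have hsplit : ∀ φ ψ : Site d ((n + 1) * s) → ℝ,
      ∑ x, ψ x * (((n : ℝ) + 1) ^ 2 * ∑ μ, (2 * φ x - φ (x + siteOf d ((n + 1) * s) (e μ)) - φ (x - siteOf d ((n + 1) * s) (e μ)))
        + a / ((n : ℝ) + 1) ^ d * ∑ q ∈ B n (blk n (windowMap d ((n + 1) * s) x)), φ (siteOf d ((n + 1) * s) q) + V x * φ x)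
      = ((n : ℝ) + 1) ^ 2 * ∑ μ, ∑ x, (ψ (x + siteOf d ((n + 1) * s) (e μ)) - ψ x) * (φ (x + siteOf d ((n + 1) * s) (e μ)) - φ x)
        + a / ((n : ℝ) + 1) ^ d * ∑ y : Site d s, (∑ z : Fin d → Fin (n + 1), ψ (siteOf d ((n + 1) * s) (chart n (windowMap d s y) z)))
            * ∑ z : Fin d → Fin (n + 1), φ (siteOf d ((n + 1) * s) (chart n (windowMap d s y) z))
        + ∑ x, V x * (ψ x * φ x) := by
    intro φ ψ
    rw [← blockForm_polarised n s φ ψ]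
    have hlap : ∑ μ, ∑ x, (ψ (x + siteOf d ((n + 1) * s) (e μ)) - ψ x) * (φ (x + siteOf d ((n + 1) * s) (e μ)) - φ x)
        = ∑ x, ψ x * ∑ μ, (2 * φ x - φ (x + siteOf d ((n + 1) * s) (e μ)) - φ (x - siteOf d ((n + 1) * s) (e μ))) := by
      symm
      calc ∑ x, ψ x * ∑ μ, (2 * φ x - φ (x + siteOf d ((n + 1) * s) (e μ)) - φ (x - siteOf d ((n + 1) * s) (e μ)))
          = ∑ x, ∑ μ, ψ x * (2 * φ x - φ (x + siteOf d ((n + 1) * s) (e μ)) - φ (x - siteOf d ((n + 1) * s) (e μ))) :=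
            Finset.sum_congr rfl fun x _ => Finset.mul_sum _ _ _
        _ = ∑ μ, ∑ x, ψ x * (2 * φ x - φ (x + siteOf d ((n + 1) * s) (e μ)) - φ (x - siteOf d ((n + 1) * s) (e μ))) :=
            Finset.sum_comm
        _ = _ := Finset.sum_congr rfl fun μ _ => lapForm_polarised (siteOf d ((n + 1) * s) (e μ)) φ ψ
    rw [hlap, Finset.mul_sum, Finset.mul_sum, ← Finset.sum_add_distrib, ← Finset.sum_add_distrib]
    exact Finset.sum_congr rfl fun x _ => by ring
  rw [hsplit φ ψ, hsplit ψ φ]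
  have h1 : ∀ μ : Fin d, ∑ x, (ψ (x + siteOf d ((n + 1) * s) (e μ)) - ψ x) * (φ (x + siteOf d ((n + 1) * s) (e μ)) - φ x)
      = ∑ x, (φ (x + siteOf d ((n + 1) * s) (e μ)) - φ x) * (ψ (x + siteOf d ((n + 1) * s) (e μ)) - ψ x) := fun μ =>
    Finset.sum_congr rfl fun x _ => mul_comm _ _
  have h2 : ∑ x, V x * (ψ x * φ x) = ∑ x, V x * (φ x * ψ x) := Finset.sum_congr rfl fun x _ => by ring
  simp only [h1, h2]
  congr 1; congr 1
  exact congrArg _ (Finset.sum_congr rfl fun y _ => mul_comm _ _)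

/-- **THE DISPLAYED ACTION IS LINEAR — differences**: `H(u − u′) = Hu − Hu′` pointwise. [folklore] -/
theorem action_sub (V u u' : Site d ((n + 1) * s) → ℝ) (x : Site d ((n + 1) * s)) :
    ((n : ℝ) + 1) ^ 2 * ∑ μ, (2 * (u x - u' x) - (u (x + siteOf d ((n + 1) * s) (e μ)) - u' (x + siteOf d ((n + 1) * s) (e μ)))
          - (u (x - siteOf d ((n + 1) * s) (e μ)) - u' (x - siteOf d ((n + 1) * s) (e μ))))
        + a / ((n : ℝ) + 1) ^ d * ∑ q ∈ B n (blk n (windowMap d ((n + 1) * s) x)), (u (siteOf d ((n + 1) * s) q) - u' (siteOf d ((n + 1) * s) q))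
        + V x * (u x - u' x)
      = (((n : ℝ) + 1) ^ 2 * ∑ μ, (2 * u x - u (x + siteOf d ((n + 1) * s) (e μ)) - u (x - siteOf d ((n + 1) * s) (e μ)))
          + a / ((n : ℝ) + 1) ^ d * ∑ q ∈ B n (blk n (windowMap d ((n + 1) * s) x)), u (siteOf d ((n + 1) * s) q) + V x * u x)
        - (((n : ℝ) + 1) ^ 2 * ∑ μ, (2 * u' x - u' (x + siteOf d ((n + 1) * s) (e μ)) - u' (x - siteOf d ((n + 1) * s) (e μ)))
          + a / ((n : ℝ) + 1) ^ d * ∑ q ∈ B n (blk n (windowMap d ((n + 1) * s) x)), u' (siteOf d ((n + 1) * s) q) + V x * u' x) := by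
  rw [Finset.sum_sub_distrib (f := fun q => u (siteOf d ((n + 1) * s) q)),
    show ∑ μ : Fin d, (2 * (u x - u' x) - (u (x + siteOf d ((n + 1) * s) (e μ)) - u' (x + siteOf d ((n + 1) * s) (e μ)))
          - (u (x - siteOf d ((n + 1) * s) (e μ)) - u' (x - siteOf d ((n + 1) * s) (e μ))))
        = ∑ μ : Fin d, (2 * u x - u (x + siteOf d ((n + 1) * s) (e μ)) - u (x - siteOf d ((n + 1) * s) (e μ)))
          - ∑ μ : Fin d, (2 * u' x - u' (x + siteOf d ((n + 1) * s) (e μ)) - u' (x - siteOf d ((n + 1) * s) (e μ))) by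
      rw [← Finset.sum_sub_distrib]; exact Finset.sum_congr rfl fun μ _ => by ring]
  ring

/-- **THE DISPLAYED ACTION IS LINEAR — superpositions**: `H(Σ_{i∈I} c_i u_i)(x) = Σ_{i∈I} c_i·(Hu_i)(x)`. [folklore] -/
theorem action_sum_smul {ι : Type*} (I : Finset ι) (c : ι → ℝ) (u : ι → Site d ((n + 1) * s) → ℝ) (V : Site d ((n + 1) * s) → ℝ)
    (x : Site d ((n + 1) * s)) :
    ((n : ℝ) + 1) ^ 2 * ∑ μ, (2 * (∑ i ∈ I, c i * u i x) - (∑ i ∈ I, c i * u i (x + siteOf d ((n + 1) * s) (e μ)))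
          - (∑ i ∈ I, c i * u i (x - siteOf d ((n + 1) * s) (e μ))))
        + a / ((n : ℝ) + 1) ^ d * ∑ q ∈ B n (blk n (windowMap d ((n + 1) * s) x)), (∑ i ∈ I, c i * u i (siteOf d ((n + 1) * s) q))
        + V x * (∑ i ∈ I, c i * u i x)
      = ∑ i ∈ I, c i * (((n : ℝ) + 1) ^ 2 * ∑ μ, (2 * u i x - u i (x + siteOf d ((n + 1) * s) (e μ)) - u i (x - siteOf d ((n + 1) * s) (e μ)))
          + a / ((n : ℝ) + 1) ^ d * ∑ q ∈ B n (blk n (windowMap d ((n + 1) * s) x)), u i (siteOf d ((n + 1) * s) q) + V x * u i x) := by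
  have h1 : ∑ μ : Fin d, (2 * (∑ i ∈ I, c i * u i x) - (∑ i ∈ I, c i * u i (x + siteOf d ((n + 1) * s) (e μ)))
        - (∑ i ∈ I, c i * u i (x - siteOf d ((n + 1) * s) (e μ))))
      = ∑ i ∈ I, c i * ∑ μ : Fin d, (2 * u i x - u i (x + siteOf d ((n + 1) * s) (e μ)) - u i (x - siteOf d ((n + 1) * s) (e μ))) := by
    calc ∑ μ : Fin d, (2 * (∑ i ∈ I, c i * u i x) - (∑ i ∈ I, c i * u i (x + siteOf d ((n + 1) * s) (e μ)))
            - (∑ i ∈ I, c i * u i (x - siteOf d ((n + 1) * s) (e μ))))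
        = ∑ μ : Fin d, ∑ i ∈ I, c i * (2 * u i x - u i (x + siteOf d ((n + 1) * s) (e μ)) - u i (x - siteOf d ((n + 1) * s) (e μ))) :=
          Finset.sum_congr rfl fun μ _ => by
            rw [Finset.mul_sum, ← Finset.sum_sub_distrib, ← Finset.sum_sub_distrib]
            exact Finset.sum_congr rfl fun i _ => by ring
      _ = ∑ i ∈ I, ∑ μ : Fin d, c i * (2 * u i x - u i (x + siteOf d ((n + 1) * s) (e μ)) - u i (x - siteOf d ((n + 1) * s) (e μ))) :=
          Finset.sum_comm
      _ = _ := Finset.sum_congr rfl fun i _ => (Finset.mul_sum _ _ _).symm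
  have h2 : ∑ q ∈ B n (blk n (windowMap d ((n + 1) * s) x)), (∑ i ∈ I, c i * u i (siteOf d ((n + 1) * s) q))
      = ∑ i ∈ I, c i * ∑ q ∈ B n (blk n (windowMap d ((n + 1) * s) x)), u i (siteOf d ((n + 1) * s) q) := by
    rw [Finset.sum_comm]
    exact Finset.sum_congr rfl fun i _ => (Finset.mul_sum _ _ _).symm
  rw [h1, h2, Finset.mul_sum, Finset.mul_sum, Finset.mul_sum, ← Finset.sum_add_distrib, ← Finset.sum_add_distrib]
  exact Finset.sum_congr rfl fun i _ => by ring

/-- **THE DISPLAYED ACTION IS INJECTIVE** when `V ≥ −λ`, `λ < min(2,a)`, `a ≥ 0`: `Hu = Hu′` pointwise ⟹ `u = u′` ((131)'s resolvent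
letter at the zero weight applied to `u − u′`). [folklore] -/
theorem action_injective (ha : 0 ≤ a) {lam : ℝ} (hm : 0 < min 2 a - lam) (V : Site d ((n + 1) * s) → ℝ) (hV : ∀ x, -lam ≤ V x)
    (u u' : Site d ((n + 1) * s) → ℝ)
    (h : ∀ x, ((n : ℝ) + 1) ^ 2 * ∑ μ, (2 * u x - u (x + siteOf d ((n + 1) * s) (e μ)) - u (x - siteOf d ((n + 1) * s) (e μ)))
        + a / ((n : ℝ) + 1) ^ d * ∑ q ∈ B n (blk n (windowMap d ((n + 1) * s) x)), u (siteOf d ((n + 1) * s) q) + V x * u x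
      = ((n : ℝ) + 1) ^ 2 * ∑ μ, (2 * u' x - u' (x + siteOf d ((n + 1) * s) (e μ)) - u' (x - siteOf d ((n + 1) * s) (e μ)))
        + a / ((n : ℝ) + 1) ^ d * ∑ q ∈ B n (blk n (windowMap d ((n + 1) * s) x)), u' (siteOf d ((n + 1) * s) q) + V x * u' x) :
    u = u' := by
  set v : Site d ((n + 1) * s) → ℝ := fun x => u x - u' x with hv
  have hHv : ∀ x, ((n : ℝ) + 1) ^ 2 * ∑ μ, (2 * v x - v (x + siteOf d ((n + 1) * s) (e μ)) - v (x - siteOf d ((n + 1) * s) (e μ)))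
      + a / ((n : ℝ) + 1) ^ d * ∑ q ∈ B n (blk n (windowMap d ((n + 1) * s) x)), v (siteOf d ((n + 1) * s) q) + V x * v x
      = (fun _ => (0 : ℝ)) x := by
    intro x
    simp only [hv]
    rw [action_sub n a s V u u' x, h x, sub_self]
  have hm' : 0 < min 2 a - lam - 2 * d * (((n : ℝ) + 1) * 0) ^ 2 - a * (exp 0 - 1) := by simpa using hm
  have hres := SupTorusHessianCombesThomas.weighted_resolvent_le n a s ha v (fun _ => 0) V (fun _ => 0) (τ := 0) (β := 0)
    (lam := lam) zero_le_one (fun _ _ => by simp) (fun _ _ _ => by simp) hV hm' hHv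
  simp only [exp_zero, one_mul, mul_zero, zero_pow two_ne_zero, Finset.sum_const_zero, Real.sqrt_zero] at hres
  have hS : ∑ x, v x ^ 2 ≤ 0 := Real.sqrt_eq_zero'.1 (le_antisymm hres (Real.sqrt_nonneg _))
  funext x
  have hx : v x ^ 2 ≤ 0 := (Finset.single_le_sum (fun x _ => sq_nonneg (v x)) (Finset.mem_univ x)).trans hS
  have : v x = 0 := by nlinarith [sq_nonneg (v x)]
  simpa [hv, sub_eq_zero] using this

end Forms

/-! ## §2. Block bookkeeping: indicators, block sums, the weight on a block -/

section Blocks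

variable (n s : ℕ) [NeZero s]

/-- **A BLOCK INDICATOR PAIRS TO THE BLOCK SUM**: `Σ_x 𝟙[bt x = y]·f x = Σ_z f(σ(chart n (wm y) z))`, `bt x = σ_s(blk n (wm x))` the torus
block map (TDF `sum_blockLift_mul`). [folklore] -/
theorem sum_indicator_mul (y : Site d s) (f : Site d ((n + 1) * s) → ℝ) :
    ∑ x, (if siteOf d s (blk n (windowMap d ((n + 1) * s) x)) = y then (1 : ℝ) else 0) * f x
      = ∑ z : Fin d → Fin (n + 1), f (siteOf d ((n + 1) * s) (chart n (windowMap d s y) z)) := by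
  classical
  have h := SupTorusDirichletForm.sum_blockLift_mul n s (fun y'' => if y'' = y then (1 : ℝ) else 0) f
  rw [h, ← sum_B (windowMap d s y) (fun p => f (siteOf d ((n + 1) * s) p))]
  simp only [ite_mul, one_mul, zero_mul, Finset.sum_ite_eq', Finset.mem_univ, if_true]

/-- A block sum of a nonnegative function is at most the total sum. [folklore] -/
theorem block_sum_le_total (y : Site d s) {F : Site d ((n + 1) * s) → ℝ} (hF : ∀ x, 0 ≤ F x) :
    ∑ z : Fin d → Fin (n + 1), F (siteOf d ((n + 1) * s) (chart n (windowMap d s y) z)) ≤ ∑ x, F x := by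
  classical
  rw [sum_fine_eq_sum_blocks n s F, ← sum_B (windowMap d s y) (fun p => F (siteOf d ((n + 1) * s) p))]
  exact Finset.single_le_sum (f := fun y'' : Site d s => ∑ p ∈ B n (windowMap d s y''), F (siteOf d ((n + 1) * s) p))
    (fun y'' _ => Finset.sum_nonneg fun p _ => hF _) (Finset.mem_univ y)

/-- **THE DISTANCE TO A BLOCK CORNER, READ ON A BLOCK**: for `x = σ(chart n (wm y) z)` and the corner `c′ = σ(chart n (wm y′) 0)`,
`(n+1)ρ_s(y,y′) − dn ≤ ρ_N(x, c′) ≤ (n+1)ρ_s(y,y′) + dn`; hence with `0 ≤ κ`: `κρ_s(y,y′) − dκ ≤ κρ_N(x,c′)∕(n+1) ≤ κρ_s(y,y′) + dκ`.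
[folklore] -/
theorem weight_on_block (y y' : Site d s) (z : Fin d → Fin (n + 1)) {κ : ℝ} (hκ : 0 ≤ κ) :
    κ * (∑ i, (((y i - y' i).valMinAbs.natAbs : ℕ) : ℝ)) - d * κ
        ≤ κ / ((n : ℝ) + 1) * ∑ i, ((((siteOf d ((n + 1) * s) (chart n (windowMap d s y) z)) i
              - (siteOf d ((n + 1) * s) (chart n (windowMap d s y') 0)) i).valMinAbs.natAbs : ℕ) : ℝ)
      ∧ κ / ((n : ℝ) + 1) * ∑ i, ((((siteOf d ((n + 1) * s) (chart n (windowMap d s y) z)) i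
              - (siteOf d ((n + 1) * s) (chart n (windowMap d s y') 0)) i).valMinAbs.natAbs : ℕ) : ℝ)
        ≤ κ * (∑ i, (((y i - y' i).valMinAbs.natAbs : ℕ) : ℝ)) + d * κ := by
  obtain ⟨h1, h2⟩ := fine_coarse_compare n s y y' z 0
  have hn : (0 : ℝ) < (n : ℝ) + 1 := by positivity
  have hdn : (d : ℝ) * n / ((n : ℝ) + 1) ≤ d := by
    rw [div_le_iff₀ hn]; nlinarith [Nat.cast_nonneg (α := ℝ) d, Nat.cast_nonneg (α := ℝ) n]
  have hd : (0 : ℝ) ≤ d := Nat.cast_nonneg d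
  constructor
  · have := mul_le_mul_of_nonneg_left h1 (div_nonneg hκ hn.le)
    have e : κ / ((n : ℝ) + 1) * (((n : ℝ) + 1) * (∑ i, (((y i - y' i).valMinAbs.natAbs : ℕ) : ℝ)) - d * n)
        = κ * (∑ i, (((y i - y' i).valMinAbs.natAbs : ℕ) : ℝ)) - κ * (d * n / ((n : ℝ) + 1)) := by
      field_simp
    rw [e] at this
    nlinarith [mul_le_mul_of_nonneg_left hdn hκ]
  · have := mul_le_mul_of_nonneg_left h2 (div_nonneg hκ hn.le)
    have e : κ / ((n : ℝ) + 1) * (((n : ℝ) + 1) * (∑ i, (((y i - y' i).valMinAbs.natAbs : ℕ) : ℝ)) + d * n)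
        = κ * (∑ i, (((y i - y' i).valMinAbs.natAbs : ℕ) : ℝ)) + κ * (d * n / ((n : ℝ) + 1)) := by
      field_simp
    rw [e] at this
    nlinarith [mul_le_mul_of_nonneg_left hdn hκ]

end Blocks

/-! ## §3. Toy -/

/-- Toy (`d = 1`, `n = 0`, `s = 1`): the block indicator of the one block of the one-point torus pairs `f` to its one-term block sum. -/
example (y : Site 1 1) (f : Site 1 ((0 + 1) * 1) → ℝ) :
    ∑ x, (if siteOf 1 1 (blk 0 (windowMap 1 ((0 + 1) * 1) x)) = y then (1 : ℝ) else 0) * f x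
      = ∑ z : Fin 1 → Fin (0 + 1), f (siteOf 1 ((0 + 1) * 1) (chart 0 (windowMap 1 1 y) z)) :=
  sum_indicator_mul 0 1 y f

end Summit.QuantumFields.BalabanUV.T4Continuum.NE7b.SupTorusActionForm
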